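import Literature.NumberTheory.EllipticCurves.CongruenceNumber
import Literature.NumberTheory.EllipticCurves.CongruenceNumberCyclicProofs
import Literature.NumberTheory.EllipticCurves.PastenSpectralDegreeHomologyProofs
import Literature.NumberTheory.EllipticCurves.ModularJacobianMultiplicityOneCosocleProofs
import Literature.NumberTheory.EllipticCurves.ModularDegreeMinimal
import Summits.ABC.ABC.Theses.DefiniteXi
import HarnessLib

/-!
# STUB-IDEAS k1 · GEN 17 companion sketch — `stub_xiDegreeComparison` (crux `SteinbergCore`, stmt-ABC-15024)

Scratch, not a Theorems file.  The ONE remaining print debt of registered stub 1 (g11/g15/g16: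
`Stub ⟸ XiCongruenceComparison (PROVED, g11) ∧ OneSidedARS ∧ FreyModularity`) is the ONE-SIDED
Agashe–Ribet–Stein inequality `ord_p r_f ≤ ord_p deg φ` (`p ≥ 5`, Frey curves).  GEN 17 = Family 1
import N1′ ("denominator of the idempotent", Cojocaru–Kani 2004 §2.4–2.6 + ARS 2012 §5, Lemma 5.5 /
Lemma 5.8 road — NOT their Prop 5.10 / Lemma 5.11 road through multiplicity one for differentials)
run on the tree's ANALYTIC model `H = periodHomology N ⊆ S₂(Γ₀(N))^∨` in the idiom of
`PastenSpectralDegreeHomologyProofs` (`t g = μ_g • f`, `μ_g ⟨f,f⟩ = R ⟨f,g⟩`).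

Typed here as `def … : Prop` (statements the helper lemmas should have; all elaborate, no `sorry`):
* `ProjectorInRationalHecke`      (L2)  `n · π_f ∈ 𝕋_ℤ` for some `n ≥ 1` (spectral: AL multiplicity one +
                                        self-adjointness, both PROVED in the tree);
* `UnimodularityConverse`         (hRB⁻¹, hypothesis) the converse of Pasten's `hRB`: a Petersson
                                        functional pairing `4π²`-integrally with `H` lies in `H`;
* `DegProjectorPreservesHomology` (L4)  `(deg φ_D · π_f)^∨ H ⊆ H` for EVERY datum `D` (Zagier's degree
                                        formula, PROVED, + the area lemma; no optimality/minimality);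
* `TwoGeneratorsUpToUnit`         (L3a) Nakayama: cosocle `≤ 2` ⇒ `s Λ ⊆ 𝕋y₁ + 𝕋y₂`, `s ∉ 𝔪`;
* `RankTwo`                       (L7)  Eichler–Shimura rank count `H_ℚ ≅ 𝕋_ℚ²` (rational freeness);
* `IndependentUpToUnit`           (L3b) Fitting + dimension count: relations are killed by some `s' ∉ 𝔪`;
* `SaturationAtPrime`             (L3c) `u = t/d ∈ 𝕋_ℚ`, `uΛ ⊆ Λ` ⇒ `s'' u ∈ 𝕋`, `s'' ∉ 𝔪` — PROVED below;
* `FreyWilesData`                 (L6)  the hypothesis list of `wiles1995_multiplicityOne` at `𝔪 = (p, I_f)`,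
                                        `p ≥ 5`, for Frey curves (all ingredients are tree theorems + the
                                        named fact `mazurKenku_exists_cyclic_isogeny`);
* `OneSidedARSFrey`               (target of N1′) `ord_p r_f ≤ ord_p deg φ_D`, `p ≥ 5`, EVERY datum `D`;
* `N1Assembly`                    the claimed implication (shape only).
L1 (`r_f = den_{S₂(ℤ)}(π_f)`) is already in the tree: `exists_int_congruenceNumber_mul_peterssonProduct_eq`,
`exists_congruenceNumber_mul_peterssonProduct_eq_self`, `exists_sub_eq_congruenceNumber_smul`.
Nothing here restates or weakens the crux or the stub.
-/

set_option linter.dupNamespace false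
set_option autoImplicit false

noncomputable section

namespace Summit.ABC.ABC.Cruxes.SteinbergCore.StubIdeasK1G17

open scoped MatrixGroups ModularForm NumberField
open CongruenceSubgroup Polynomial IsDedekindDomain
open Literature.NumberTheory.EllipticCurves Literature.NumberTheory.EllipticCurves.ModularForms
open Literature.NumberTheory.Automorphic
open Literature.NumberTheory.GaloisRepresentations
open Rat.HeightOneSpectrum

/-! ## L2 — the orthogonal projector onto `ℂ f` lies in `𝕋 ⊗ ℚ` -/

/-- **L2** (`π_f ∈ 𝕋_ℚ`): for the newform `f = D.f` of a modular parametrisation there are `n ≥ 1` and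
`s ∈ 𝕋_ℤ = HeckeRing0 N 2` with `s = n · π_f`, `π_f` the Petersson-orthogonal projector onto `ℂ f`,
written in the projector idiom of `PastenSpectralDegreeHomologyProofs` (`s g = μ_g f`, `μ_g⟨f,f⟩ = n⟨f,g⟩`).
Route: `𝕋_ℚ` is a commutative Artinian algebra acting on `S₂`; the generalised `λ_f`-eigenspace is `ℂ f`
(Atkin–Lehner multiplicity one, `atkinLehner_multiplicityOne_holds`) and is Petersson-orthogonal to the
other generalised eigenspaces (`heckeT_selfAdjoint_holds` for `p ∤ N` separates eigencharacters by strong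
multiplicity one); the corresponding primitive idempotent of `𝕋_ℚ` is `π_f`.
[cite: CojocaruKani2004, §2.4 eq. (9), §2.6] [cite: AgasheRibetStein2012, §5 (T′ = End(J) ∩ (T ⊗ ℚ))] -/
def ProjectorInRationalHecke : Prop :=
  ∀ (W : WeierstrassCurve ℚ) [W.IsElliptic] (N : ℕ) [NeZero N] (D : ModularParametrizationData W N),
    ∃ (n : ℕ) (s : HeckeRing0 N 2), n ≠ 0 ∧
      ∀ g : CuspForm (Gamma0 N) 2, ∃ μ : ℂ, HeckeRing0.toEnd N 2 s g = μ • D.f ∧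
        μ * peterssonProduct (Gamma0 N) 2 D.f D.f = (n : ℂ) * peterssonProduct (Gamma0 N) 2 D.f g

/-! ## hRB⁻¹ and L4 — `deg φ · π_f` preserves the period homology (the direction ARS need, NOT Pasten L.5.6) -/

/-- **hRB⁻¹** (unimodularity of the Riemann form on `H = H₁(X₀(N), ℤ)`, the converse of the hypothesis
`hRB` of `ModularParametrizationData.modularDegree_dvd_of_periodRelations`): a functional `θ = ⟨h, ·⟩`
whose Riemann pairings `Im φ(h)` with all `φ ∈ H` lie in `4π² ℤ` belongs to `H`.  (Principal polarisation
of `J₀(N)`: Riemann's bilinear relations, Farkas–Kra III.1.1; checked by hand at `N = 11` against the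
PROVED `zagier_degree_formula_holds`.)  A HYPOTHESIS of L4, like `hRB` in Pasten's file.
[cite: FarkasKra1992, III.1.1 (1.1.6)] -/
def UnimodularityConverse (N : ℕ) [NeZero N] : Prop :=
  ∀ (θ : Module.Dual ℂ (CuspForm (Gamma0 N) 2)) (h : CuspForm (Gamma0 N) 2),
    (∀ g, θ g = peterssonProduct (Gamma0 N) 2 h g) →
    (∀ φ ∈ periodHomology N, ∃ n : ℤ, (φ h).im = 4 * Real.pi ^ 2 * n) →
    θ ∈ periodHomology N

/-- **L4** (`(deg φ_D · π_f)^∨ H ⊆ H` for EVERY datum `D`, no optimality, no minimality): if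
`t ∈ End S₂` acts as `deg φ_D · π_f` (projector idiom), then `t^∨` preserves `H`.  Proof sketch:
`(t^∨ψ)(g) = μ_g ψ(f) = ⟨h, g⟩` with `h = conj(deg·ψ(f)/⟨f,f⟩) • f`; for `φ ∈ H`,
`Im φ(h) = deg · Im(conj(ψ f) φ(f))/⟨f,f⟩ = 4π² c² Im(conj λ · ν)/covol(Λ_W)` by Zagier
(`zagier_degree_formula_holds`: `4π² c² ⟨f,f⟩ = deg · covol(D.L.lattice)`), with `λ = ψ f, ν = φ f ∈ Λ_f`,
`cλ, cν ∈ Λ_W` (`D.smul_periodLattice_le`), and `Im(ū v) ∈ covol(Λ_W) ℤ` for `u, v ∈ Λ_W`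
(`covolume_lattice_eq_abs_im`); conclude by `UnimodularityConverse`.  Geometrically: `φ_D^* ∘ φ_{D,*} ∈ End J₀(N)`
acts on `Lie = S₂^∨` as `(deg φ_D · π_f)^∨`.
[cite: ZagierCMB1985, §1 (p. 374)] [cite: AgasheRibetStein2012, §4 (proof of Lemma 4.1), §5 Lemma 5.5] -/
def DegProjectorPreservesHomology : Prop :=
  ∀ (W : WeierstrassCurve ℚ) [W.IsElliptic] (N : ℕ) [NeZero N] (D : ModularParametrizationData W N),
    UnimodularityConverse N →
    ∀ t : Module.End ℂ (CuspForm (Gamma0 N) 2),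
      (∀ g : CuspForm (Gamma0 N) 2, ∃ μ : ℂ, t g = μ • D.f ∧
        μ * peterssonProduct (Gamma0 N) 2 D.f D.f = (D.deg : ℂ) * peterssonProduct (Gamma0 N) 2 D.f g) →
      ∀ ψ ∈ periodHomology N, t.dualMap ψ ∈ periodHomology N

/-! ## L3a / L7 / L3b / L3c — saturation of `𝕋` in `𝕋' = {u ∈ 𝕋_ℚ : uΛ ⊆ Λ}` at a multiplicity-one `𝔪`
(ARS Lemma 5.8, phrased with `∃ s ∉ 𝔪` instead of localisation/completion) -/

/-- **L3a** (Nakayama, two generators up to a unit at `𝔪`): if `dim_{𝕋/𝔪} Λ/𝔪Λ ≤ 2`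
(`finrank_periodHomology_quotient_eq_two_of_wiles` gives `= 2`) then some `y₁, y₂ ∈ Λ` generate `Λ` after
inverting some `s ∉ 𝔪`: `sΛ ⊆ 𝕋y₁ + 𝕋y₂`.  (Mathlib: `Submodule.exists_sub_one_mem_and_smul_eq_zero_of_fg_of_le_smul`
applied to `Λ/(𝕋y₁ + 𝕋y₂)`.) [cite: AtiyahMacdonald1969, Prop. 2.8, Cor. 2.7] -/
def TwoGeneratorsUpToUnit : Prop :=
  ∀ (N : ℕ) [NeZero N] (𝔪 : Ideal (HeckeRing0 N 2)), 𝔪.IsMaximal →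
    Module.finrank (HeckeRing0 N 2 ⧸ 𝔪)
        (periodHomologyHecke N ⧸ 𝔪 • (⊤ : Submodule (HeckeRing0 N 2) (periodHomologyHecke N))) ≤ 2 →
    ∃ (y₁ y₂ : periodHomologyHecke N) (s : HeckeRing0 N 2), s ∉ 𝔪 ∧
      ∀ x : periodHomologyHecke N, ∃ a b : HeckeRing0 N 2, s • x = a • y₁ + b • y₂

/-- **L7** (Eichler–Shimura rank count, rational form): `H₁(X₀(N), ℚ)` is free of rank two over `𝕋_ℚ` —
two elements `x₁, x₂ ∈ Λ` without `𝕋`-relations whose `𝕋`-span has finite index `∣ d` in `Λ`.  Route: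
`S₂^∨ ≅ 𝕋_ℂ` as `𝕋_ℂ`-modules by q-expansion duality (`eq_zero_of_forall_heckeRing0_cuspCoeff_one`,
`exists_mem_heckeRing0_cuspCoeff_one_eq`), `Λ ⊗ ℝ = S₂^∨` (`periodHomology_eq_span_basis_holds`), descent
`ℝ → ℚ` by a nonvanishing-determinant argument.  Printed: Rohrlich 1997 (proof of Prop. 21), Tilouine 1997
Cor. (3) to Thm. 3.4 (even `𝕋_𝔪`-integrally), DDT 1995 §1.7 / §4.2.
[cite: Rohrlich1997, Prop. 21 (proof)] [cite: Tilouine1997Gorenstein, Thm. 3.4, Cor. (3)] -/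
def RankTwo (N : ℕ) [NeZero N] : Prop :=
  ∃ (x₁ x₂ : periodHomologyHecke N) (d : ℕ), d ≠ 0 ∧
    (∀ a b : HeckeRing0 N 2, a • x₁ + b • x₂ = 0 → a = 0 ∧ b = 0) ∧
    ∀ y : periodHomologyHecke N, ∃ a b : HeckeRing0 N 2, (d : HeckeRing0 N 2) • y = a • x₁ + b • x₂

/-- **L3b** (independence up to a unit at `𝔪`): with the rank count, generators `y₁, y₂` of `Λ[1/s]` have
all their `𝕋`-relations killed by one `s' ∉ 𝔪`.  Route: Fitting decomposition of multiplication by `s` on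
`𝕋_ℚ` (Mathlib `Module.End.eventually_isCompl_ker_pow_range_pow`; tree
`Literature.Algebra.Module.FittingLemmaIndecomposable.exists_isCompl_ker_pow_range_pow`): on the direct
factor `𝕋₁ = s^k 𝕋_ℚ` (where `s` is a unit) `𝕋₁² ↠ 𝕋₁Λ_ℚ ≅ 𝕋₁²` is a surjection of equal `ℚ`-dimension,
hence injective; so `a y₁ + b y₂ = 0 ⇒ s^k a = s^k b = 0`. [cite: AgasheRibetStein2012, Lemma 5.8 (proof)] -/
def IndependentUpToUnit : Prop :=
  ∀ (N : ℕ) [NeZero N], RankTwo N → ∀ (𝔪 : Ideal (HeckeRing0 N 2)), 𝔪.IsMaximal →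
    ∀ (y₁ y₂ : periodHomologyHecke N) (s : HeckeRing0 N 2), s ∉ 𝔪 →
      (∀ x : periodHomologyHecke N, ∃ a b : HeckeRing0 N 2, s • x = a • y₁ + b • y₂) →
      ∃ s' : HeckeRing0 N 2, s' ∉ 𝔪 ∧
        ∀ a b : HeckeRing0 N 2, a • y₁ + b • y₂ = 0 → s' * a = 0 ∧ s' * b = 0

/-- **L3c** (saturation at `𝔪`, = ARS Lemma 5.8 "`T′_𝔪 = T_𝔪`" in `∃ s ∉ 𝔪` form): given L3a/L3b data
at `𝔪`, any `u = t/d ∈ 𝕋_ℚ` with `uΛ ⊆ Λ` (i.e. `tΛ ⊆ dΛ`) satisfies `s'' u ∈ 𝕋` for some `s'' ∉ 𝔪`.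
PROVED below (`saturationAtPrime`). [cite: AgasheRibetStein2012, Lemma 5.8] [cite: CojocaruKani2004, §2.6] -/
def SaturationAtPrime : Prop :=
  ∀ (N : ℕ) [NeZero N] (𝔪 : Ideal (HeckeRing0 N 2)), 𝔪.IsMaximal →
    ∀ (y₁ y₂ : periodHomologyHecke N) (s s' : HeckeRing0 N 2), s ∉ 𝔪 → s' ∉ 𝔪 →
      (∀ x : periodHomologyHecke N, ∃ a b : HeckeRing0 N 2, s • x = a • y₁ + b • y₂) →
      (∀ a b : HeckeRing0 N 2, a • y₁ + b • y₂ = 0 → s' * a = 0 ∧ s' * b = 0) →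
      ∀ (t : HeckeRing0 N 2) (d : ℕ),
        (∀ x : periodHomologyHecke N, ∃ y : periodHomologyHecke N, t • x = (d : HeckeRing0 N 2) • y) →
        ∃ s'' t' : HeckeRing0 N 2, s'' ∉ 𝔪 ∧ s'' * t = (d : HeckeRing0 N 2) * t'

/-- L3c holds: a ten-line computation in the commutative ring `𝕋` (no localisation, no completion). -/
theorem saturationAtPrime : SaturationAtPrime := by
  intro N _ 𝔪 h𝔪 y₁ y₂ s s' hs hs' hgen hind t d hdiv
  obtain ⟨z, hz⟩ := hdiv y₁
  obtain ⟨a, b, hab⟩ := hgen z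
  have key : (s * t - (d : HeckeRing0 N 2) * a) • y₁ + (-((d : HeckeRing0 N 2) * b)) • y₂ = 0 := by
    linear_combination (norm := module) s • hz + (d : HeckeRing0 N 2) • hab
  obtain ⟨h2, -⟩ := hind _ _ key
  refine ⟨s' * s, s' * a, fun h => (h𝔪.isPrime.mem_or_mem h).elim hs' hs, ?_⟩
  rw [mul_sub] at h2
  linear_combination h2

/-! ## L6 — the Frey curve meets the hypothesis list of `wiles1995_multiplicityOne` at `𝔪 = (p, I_f)`, `p ≥ 5` -/

/-- **L6** (Frey–Wiles data).  For `p ≥ 5`, coprime `a, b` with `ab(a+b) ≠ 0`, `N = N_E` and a datum `D` of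
the Frey curve: the ideal `𝔪 = ker(𝕋 →^{λ_f} ℤ → 𝔽_p)` is maximal, contains `p`, satisfies Wiles's level
condition (`p ∤ N`, or `p ∥ N` with `U_p = a_p = ±1 ∉ 𝔪`; `p² ∤ N` is g11
`not_sq_dvd_conductorNorm_freyCurve_of_ne_two`), and `ρ̄ = E[p]` is an irreducible `ModPGaloisRep` with the
matching Frobenius polynomials.  Ingredients, all in the tree: `WeierstrassCurve.exists_isTorsionGaloisRep`,
`IsTorsionGaloisRep.isUnramifiedAt_of_hasGoodReductionAt`, `charpoly_baseChange_of_isTorsionGaloisRep`,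
`isIrreducible_of_hasIrreducibleModPGaloisRep`, `hasIrreducibleModPGaloisRep_freyCurve_of_mazurKenku`
(named fact `mazurKenku_exists_cyclic_isogeny`), eigenvalues `T_n f = a_n(E) f ∈ ℤ f` (`IsNewformOf`).
[cite: DarmonDiamondTaylor1995, Thm. 4.26] [cite: Serre1987, §4.6] -/
def FreyWilesData : Prop :=
  ∀ (a b : ℤ), IsCoprime a b → a * b * (a + b) ≠ 0 →
    ∀ (N : ℕ) [NeZero N], (freyCurve a b).conductorNorm ℤ = N →
    ∀ (D : ModularParametrizationData (freyCurve a b) N) (p : ℕ) [Fact p.Prime], 5 ≤ p →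
      ∃ (𝔪 : Ideal (HeckeRing0 N 2)) (_ : 𝔪.IsMaximal),
        (p : HeckeRing0 N 2) ∈ 𝔪 ∧
        (∀ t : HeckeRing0 N 2, ∃ c : ℤ, HeckeRing0.toEnd N 2 t D.f = (c : ℂ) • D.f ∧ (t ∈ 𝔪 ↔ (p : ℤ) ∣ c)) ∧
        (¬ p ∣ N ∨ (¬ p ^ 2 ∣ N ∧ HeckeRing0.T N 2 p Fact.out ∉ 𝔪)) ∧
        ∃ (ι : HeckeRing0 N 2 ⧸ 𝔪 →+* ZMod p) (ρ : ModPGaloisRep ℚ (ZMod p) 2),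
          FramedRep.IsIrreducible ρ ∧
          ∀ v : HeightOneSpectrum (𝓞 ℚ), ¬ ((primesEquiv v : Nat.Primes) : ℕ) ∣ N * p →
            ρ.IsUnramifiedAt v ∧
              ρ.HasFrobCharpolyAt v
                (X ^ 2
                  - C (ι (Ideal.Quotient.mk 𝔪 (HeckeRing0.T N 2
                      ((primesEquiv v : Nat.Primes) : ℕ) (primesEquiv v : Nat.Primes).2))) * X
                  + C (((primesEquiv v : Nat.Primes) : ℕ) : ZMod p))

/-! ## Target of N1′ and the assembly shape -/

/-- **OneSidedARS for Frey curves**, `p ≥ 5`, for EVERY datum `D` (no minimality: `deg φ_D` is a multiple of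
the optimal degree; equivalently L4 needs none).  Implies the Frey instances of the g15/g16 `OneSidedARS`
consumed by `stub_of_xiCongruenceComparison_oneSided` (drop `hmin`, `hsq`; `D.modularDegree = D.deg` by
`deg_eq_modularDegree`). [cite: AgasheRibetStein2012, Thm. 2.1(b) / Thm. 3.6(b)] -/
def OneSidedARSFrey : Prop :=
  ∀ (a b : ℤ), IsCoprime a b → a * b * (a + b) ≠ 0 →
    ∀ (N : ℕ) [NeZero N], (freyCurve a b).conductorNorm ℤ = N →
    ∀ (D : ModularParametrizationData (freyCurve a b) N) (p : ℕ), p.Prime → 5 ≤ p →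
      padicValNat p (congruenceNumber D.f) ≤ padicValNat p D.modularDegree

/-- **N1′ assembly** (the theorem the helper lemmas compose to; shape only, to be proved by the prover as
`oneSidedARSFrey_of`).  Chain at a fixed `p ≥ 5`, datum `D`, `𝔪` from L6:
cosocle `= 2` (`finrank_periodHomology_quotient_eq_two_of_wiles` ⟸ Wiles fact + pairing fact + L6) →
L3a `y₁,y₂,s` → L3b `s'` → with `u = deg·π_f = (deg/n)·s₀` (`s₀ = n π_f ∈ 𝕋` by L2) and `uΛ ⊆ Λ` by L4
(transpose idiom: `(toEnd t).dualMap ψ ∈ H`), L3c gives `s'' ∉ 𝔪`, `t'` with `s''·deg·s₀ = n·t'`, so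
`t'` acts on `S₂` as `λ_f(s'')·deg·π_f` and preserves `S₂(ℤ)` (`apply_mem_span_of_mem_heckeRing0`) ⇒ by L1
(`exists_sub_eq_congruenceNumber_smul` / `exists_int_congruenceNumber_mul_peterssonProduct_eq`:
`{m : m π_f S₂(ℤ) ⊆ S₂(ℤ)} = r_f ℤ`) `r_f ∣ λ_f(s'')·deg`, and `p ∤ λ_f(s'')` (L6: `s'' ∉ 𝔪`). -/
def N1Assembly : Prop :=
  ProjectorInRationalHecke → DegProjectorPreservesHomology → TwoGeneratorsUpToUnit →
    IndependentUpToUnit → SaturationAtPrime → FreyWilesData →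
    (∀ (N : ℕ) [NeZero N], RankTwo N) → (∀ (N : ℕ) [NeZero N], UnimodularityConverse N) →
    wiles1995_multiplicityOne → periodHomology_exists_heckeSelfAdjoint_perfectPairing →
    OneSidedARSFrey

end Summit.ABC.ABC.Cruxes.SteinbergCore.StubIdeasK1G17

end
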